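import Summits.RiemannHypothesis.RiemannHypothesis.Theorems.IntegerScrewRung512
import Summits.RiemannHypothesis.RiemannHypothesis.Theorems.IntegerScrewTailCriterion
import Summits.RiemannHypothesis.RiemannHypothesis.Theorems.IntegerScrewFiniteExceptionInertia
import Summits.RiemannHypothesis.RiemannHypothesis.Theorems.IntegerScrewPivotUpperBound
import Summits.RiemannHypothesis.RiemannHypothesis.Theorems.IntegerScrewPivotLawDefs
import Summits.RiemannHypothesis.RiemannHypothesis.Theorems.IntegerScrewDeficitLowerBound
import HarnessLib

/-!
# Costume detectors VII (SCREW pivot ladder: the propagation tail IS `FIN(H) → RH`; REFUTED over-strengthened tails) —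
# cell `rh-split`; raw quantified forms, ZERO defs; typed by rh-split-screw-neg, re-typed and filed by rh-split-typer-1

HONEST LABEL: «SPLITTING SEARCH over kernel-typed RH-EQUIVALENCES; a splitting A ∧ B ⟹ RH is CONDITIONAL
bookkeeping unless A and B are both proved; nothing here bears on the truth of RH.»

Companion of `CostumeDetectors.lean` §3 SCREW (pivot tail from the kernel base 512, diagonal / matrix / slack axes).
NEGATIVE KNOWLEDGE from card SPLIT-screw-neg (referee 16:16Z): for the nested screw Gram matrices `S_M = screwMatrix (M-1)`
with pivots `d_M = screwPivot M` (`RH ⟺ ∀ M ≥ 2, d_M > 0`, `IntegerScrew.riemannHypothesis_iff_screwPivot_pos`):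
§1 the PROPAGATION tail «for `M > H`, `S_{M-1} ≻ 0 ⟹ d_M > 0`» is literally `FIN(H) → RH` (`stepTail_iff`), is the
WEAKEST valid complement of the base (`stepTail_weakest`), is RH at the kernel base `H = 512`, and holds at SOME cut
unconditionally (vacuity trap `exists_stepTail`); §2 REFUTATIONS (not detectors), all RH-free or RH-inconsistent:
no uniform pivot floor `d_M ≥ c > 0` (`not_pivotFloor`, unconditional), no eventually non-decreasing pivots above any
cut `H ≤ 511` (`not_nondecreasingTail_of_le_511`), the floor `M·d_M ≥ log M` eventually is RH-INCONSISTENT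
(`not_rh_of_logFloorTail`), and the «zero deficit» tail `d_M ≥ 2Ψ(log(M/(M−1)))` is FALSE above every cut
`121 ≤ H ≤ 512` and RH-inconsistent above every cut (`not_zeroDeficitTail_of_le_512`, `not_rh_of_zeroDeficitTail`).
Inside this namespace the bare token `RiemannHypothesis` is `Summit.RiemannHypothesis`; Mathlib's is `_root_.RiemannHypothesis`.
-/

noncomputable section

-- D-0017: `Summit.<S>.<S>.…` is the designed namespace of a single-problem summit.
set_option linter.dupNamespace false

namespace Summit.RiemannHypothesis.RiemannHypothesis.Theorems.Splittings.CostumeDetectorsScrew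

open Literature.NumberTheory.LFunctions
open Summit.RiemannHypothesis.RiemannHypothesis.Theorems.IntegerScrew
open Summit.RiemannHypothesis.RiemannHypothesis.Theses.IntegerScrew

/-- The kernel-certified base: `d_M > 0` for `2 ≤ M ≤ 512` (tree `screwPivot_pos_of_le_512`, standard axioms). [folklore] -/
theorem screwBase_512 : ∀ M : ℕ, 2 ≤ M → M ≤ 512 → 0 < screwPivot M := fun _ hM hM' ↦ screwPivot_pos_of_le_512 hM hM'

/-! ## §1 The propagation tail is exactly `FIN(H) → RH` (card SPLIT-screw-neg B3) -/

/-- Induction engine: the base up to `H` and the propagation tail above `H` give every pivot (card SPLIT-screw-neg B3). [folklore] -/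
theorem screwPivot_pos_of_fin_stepTail (H : ℕ) (hA : (∀ M : ℕ, 2 ≤ M → M ≤ H → 0 < screwPivot M)) (hB : (∀ M : ℕ, H < M → (screwMatrix (M - 2)).PosDef → 0 < screwPivot M)) :
    ∀ N : ℕ, ∀ M : ℕ, 2 ≤ M → M ≤ N + 1 → 0 < screwPivot M := by
  intro N
  induction N with
  | zero => intro M hM hMN; omega
  | succ N ih =>
    intro M hM hMN
    rcases Nat.lt_or_ge (N + 1) M with hlt | hge
    · obtain rfl : M = N + 2 := by omega
      by_cases hMH : N + 2 ≤ H
      · exact hA (N + 2) hM hMH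
      · have hPD : (screwMatrix N).PosDef :=
          screwMatrix_posDef_of_screwPivot_pos_le N ih N le_rfl
        exact hB (N + 2) (by omega) (by rw [Nat.add_sub_cancel]; exact hPD)
    · exact ih M hM (by omega)

/-- Splitting with the PROPAGATION tail: `FIN(H) ∧ StepTail(H) ⟹ RH` (strong induction on the level). [folklore] -/
theorem rh_of_fin_stepTail (H : ℕ) (hA : (∀ M : ℕ, 2 ≤ M → M ≤ H → 0 < screwPivot M)) (hB : (∀ M : ℕ, H < M → (screwMatrix (M - 2)).PosDef → 0 < screwPivot M)) : _root_.RiemannHypothesis :=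
  riemannHypothesis_iff_screwPivot_pos.mpr fun M hM =>
    screwPivot_pos_of_fin_stepTail H hA hB (M - 1) M hM (by omega)

/-- RH gives every propagation tail. [folklore] -/
theorem stepTail_of_rh (hRH : _root_.RiemannHypothesis) (H : ℕ) (hH : 1 ≤ H) : (∀ M : ℕ, H < M → (screwMatrix (M - 2)).PosDef → 0 < screwPivot M) :=
  fun M hM _ => (riemannHypothesis_iff_screwPivot_pos.mp hRH) M (by omega)

/-- Vacuity: if the base fails below `H`, the propagation tail holds for want of a hypothesis. -/
theorem stepTail_of_not_fin (H : ℕ) (hA : ¬ (∀ M : ℕ, 2 ≤ M → M ≤ H → 0 < screwPivot M)) : (∀ M : ℕ, H < M → (screwMatrix (M - 2)).PosDef → 0 < screwPivot M) := by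
  intro M hM hPD
  exfalso
  apply hA
  intro M' hM' hM'H
  exact screwPivot_pos_of_posDef_le hPD M' hM' (by omega)

/-- **The propagation tail IS `FIN(H) → RH`** (`H ≥ 1`): costume detector for the screw family's weakest complement (card SPLIT-screw-neg B3, referee 16:16Z). [folklore] -/
theorem stepTail_iff (H : ℕ) (hH : 1 ≤ H) :
    (∀ M : ℕ, H < M → (screwMatrix (M - 2)).PosDef → 0 < screwPivot M) ↔ ((∀ M : ℕ, 2 ≤ M → M ≤ H → 0 < screwPivot M) → _root_.RiemannHypothesis) := by
  constructor
  · exact fun hB hA => rh_of_fin_stepTail H hA hB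
  · intro h
    by_cases hA : (∀ M : ℕ, 2 ≤ M → M ≤ H → 0 < screwPivot M)
    · exact stepTail_of_rh (h hA) H hH
    · exact stepTail_of_not_fin H hA

/-- At the kernel base `H = 512` the propagation tail is RH (F1-free). [folklore] -/
theorem stepTail_512_iff_rh : (∀ M : ℕ, 512 < M → (screwMatrix (M - 2)).PosDef → 0 < screwPivot M) ↔ _root_.RiemannHypothesis := by
  rw [stepTail_iff 512 (by norm_num)]
  exact ⟨fun h => h screwBase_512, fun h _ => h⟩

/-- The propagation tail is the WEAKEST conjunct `B` for which `FIN(H) ∧ B → RH` is valid. -/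
theorem stepTail_weakest (H : ℕ) (hH : 1 ≤ H) (B : Prop)
    (hsplit : (∀ M : ℕ, 2 ≤ M → M ≤ H → 0 < screwPivot M) → B → _root_.RiemannHypothesis) (hB : B) : (∀ M : ℕ, H < M → (screwMatrix (M - 2)).PosDef → 0 < screwPivot M) :=
  (stepTail_iff H hH).mpr fun hA => hsplit hA hB

/-- Vacuity trap: some propagation tail holds UNCONDITIONALLY (so `∃ H, (∀ M : ℕ, H < M → (screwMatrix (M - 2)).PosDef → 0 < screwPivot M)` carries no
RH content, exactly like the Weil increment tail `exists_forall_handoffStep`). -/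
theorem exists_stepTail : ∃ H : ℕ, (∀ M : ℕ, H < M → (screwMatrix (M - 2)).PosDef → 0 < screwPivot M) := by
  by_cases hRH : _root_.RiemannHypothesis
  · exact ⟨1, stepTail_of_rh hRH 1 le_rfl⟩
  · have h : ¬ ∀ M : ℕ, 2 ≤ M → 0 < screwPivot M :=
      fun h => hRH (riemannHypothesis_iff_screwPivot_pos.mpr h)
    push Not at h
    obtain ⟨M₀, hM₀, hneg⟩ := h
    exact ⟨M₀, stepTail_of_not_fin M₀ fun hA => absurd (hA M₀ hM₀ le_rfl) (not_lt.mpr hneg)⟩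

/-! ## §2 REFUTATIONS (not detectors): over-strong pivot tails that are FALSE (RH-free) or RH-INCONSISTENT (card SPLIT-screw-neg B5/B6/B9/B10) -/

/-- `c₀ = log 2π + γ − 1 > 0` (tree `pivotLawConst`). [folklore] -/
theorem pivotLawConst_pos : 0 < pivotLawConst := by
  have hpi : Real.exp 1 < 2 * Real.pi := by
    have h1 := Real.exp_one_lt_d9
    have h2 := Real.pi_gt_three
    linarith
  have hlog : 1 < Real.log (2 * Real.pi) := (Real.lt_log_iff_exp_lt (by positivity)).mpr hpi
  have hγ : 1 / 2 < Real.eulerMascheroniConstant := Real.one_half_lt_eulerMascheroniConstant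
  unfold pivotLawConst
  linarith

/-- `log x ≤ 2√x` for `x > 0`. [folklore] -/
theorem log_le_two_sqrt (x : ℝ) (hx : 0 < x) : Real.log x ≤ 2 * Real.sqrt x := by
  have hs : 0 < Real.sqrt x := Real.sqrt_pos.mpr hx
  have h1 : Real.log (Real.sqrt x) ≤ Real.sqrt x - 1 := Real.log_le_sub_one_of_pos hs
  have h2 : Real.log (Real.sqrt x) = Real.log x / 2 := Real.log_sqrt hx.le
  linarith

/-- From the landed pivot-law leading term: `M · 2Ψ(log(M/(M-1))) ≤ log M - c₀ + (log M + 19)/(M-1)`. -/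
theorem incrementEnergy_le (M : ℕ) (hM : 3 ≤ M) :
    (M : ℝ) * (2 * zetaScrew (Real.log ((M : ℝ) / ((M : ℝ) - 1))))
      ≤ Real.log M - pivotLawConst + (Real.log M + 19) / ((M : ℝ) - 1) := by
  have h := pivotLawLeadingTerm_holds M hM
  have := (abs_le.mp h).2
  linarith

/-- Crude but sufficient: for `M ≥ 3` with `S_{M-1} ≻ 0`, `M · d_M ≤ 4 √M + 19 - c₀`. -/
theorem level_mul_pivot_le (M : ℕ) (hM : 3 ≤ M) (hPD : (screwMatrix (M - 2)).PosDef) :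
    (M : ℝ) * screwPivot M ≤ 4 * Real.sqrt M + 19 - pivotLawConst := by
  have hM' : (3 : ℝ) ≤ M := by exact_mod_cast hM
  have h1 : screwPivot M ≤ 2 * zetaScrew (Real.log ((M : ℝ) / ((M : ℝ) - 1))) :=
    screwPivot_le_two_zetaScrew_log_div M (by omega) hPD
  have h2 := incrementEnergy_le M hM
  have hlog : Real.log M ≤ 2 * Real.sqrt M := log_le_two_sqrt M (by linarith)
  have hlog0 : 0 ≤ Real.log (M : ℝ) := Real.log_nonneg (by linarith)
  have hsqrt1 : 1 ≤ Real.sqrt M := by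
    rw [show (1 : ℝ) = Real.sqrt 1 by simp]
    exact Real.sqrt_le_sqrt (by linarith)
  have hfrac : (Real.log M + 19) / ((M : ℝ) - 1) ≤ 2 * Real.sqrt M + 19 := by
    rw [div_le_iff₀ (by linarith)]
    nlinarith
  have h3 : (M : ℝ) * screwPivot M ≤ (M : ℝ) * (2 * zetaScrew (Real.log ((M : ℝ) / ((M : ℝ) - 1)))) :=
    mul_le_mul_of_nonneg_left h1 (by linarith)
  linarith

/-- **REFUTED (unconditionally): no uniform pivot floor.** `¬ ∃ c > 0, ∀ M ≥ 2, d_M ≥ c`. -/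
theorem not_pivotFloor : ¬ ∃ c : ℝ, 0 < c ∧ ∀ M : ℕ, 2 ≤ M → c ≤ screwPivot M := by
  rintro ⟨c, hc, h⟩
  have hPD : ∀ n, (screwMatrix n).PosDef :=
    screwMatrix_posDef_of_screwPivot_pos fun M hM => lt_of_lt_of_le hc (h M hM)
  have hc0 := pivotLawConst_pos
  obtain ⟨N₀, hN₀⟩ := exists_nat_gt (23 / c)
  set N : ℕ := N₀ + 2 with hN
  have hNge : (2 : ℝ) ≤ N := by
    have : (2 : ℕ) ≤ N := by omega
    exact_mod_cast this
  have hN0real : (N₀ : ℝ) ≤ N := by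
    have : N₀ ≤ N := by omega
    exact_mod_cast this
  have hcN : 23 < c * N := by
    have : 23 / c < (N : ℝ) := lt_of_lt_of_le hN₀ hN0real
    rwa [div_lt_iff₀ hc, mul_comm] at this
  have hNN : 3 ≤ N * N := by nlinarith [show 2 ≤ N by omega]
  have hkey := level_mul_pivot_le (N * N) hNN (hPD _)
  have hsq : Real.sqrt ((N * N : ℕ) : ℝ) = N := by
    push_cast
    exact Real.sqrt_mul_self (by linarith)
  rw [hsq] at hkey
  have hfloor : c ≤ screwPivot (N * N) := h (N * N) (by omega)
  have hcast : ((N * N : ℕ) : ℝ) = (N : ℝ) * N := by push_cast; ring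
  rw [hcast] at hkey
  -- c N² ≤ N²·d ≤ 4N + 19 - c₀ < 4N + 19, but c N > 23 and N ≥ 2
  have h4 : (N : ℝ) * N * c ≤ (N : ℝ) * N * screwPivot (N * N) :=
    mul_le_mul_of_nonneg_left hfloor (by positivity)
  nlinarith

/-- **RH-INCONSISTENT: the floor `M · d_M ≥ log M` for all large `M`.** Under RH every screw matrix
is positive definite and the innovation bound + the pivot-law leading term give
`M·d_M ≤ log M − c₀ + o(1)` with `c₀ = log 2π + γ − 1 > 0`; so this tail implies `¬RH` and can
never serve as a conjunct of a splitting toward RH (it would make `A ∧ B` inconsistent). -/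
theorem not_rh_of_logFloorTail (h : ∃ M₀ : ℕ, ∀ M : ℕ, M₀ ≤ M → Real.log M ≤ M * screwPivot M) : ¬ _root_.RiemannHypothesis := by
  intro hRH
  obtain ⟨M₀, hM₀⟩ := h
  have hPD : ∀ n, (screwMatrix n).PosDef := screwMatrix_posDef_of_riemannHypothesis hRH
  have hc0 := pivotLawConst_pos
  obtain ⟨N₁, hN₁⟩ := exists_nat_gt (42 / pivotLawConst)
  set N : ℕ := N₁ + M₀ + 2 with hN
  have hNge2 : 2 ≤ N := by omega
  have hNge : (2 : ℝ) ≤ N := by exact_mod_cast hNge2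
  have hN1real : (N₁ : ℝ) ≤ N := by
    have : N₁ ≤ N := by omega
    exact_mod_cast this
  have hcN : 42 < pivotLawConst * N := by
    have : 42 / pivotLawConst < (N : ℝ) := lt_of_lt_of_le hN₁ hN1real
    rwa [div_lt_iff₀ hc0, mul_comm] at this
  have hNN : 3 ≤ N * N := by nlinarith
  have hM₀N : M₀ ≤ N * N := by nlinarith [show M₀ ≤ N by omega]
  -- the floor at level N²
  have hfl := hM₀ (N * N) hM₀N
  -- the upper bound at level N², in the sharper form with the (log M + 19)/(M-1) remainder
  have hNNr : (3 : ℝ) ≤ ((N * N : ℕ) : ℝ) := by exact_mod_cast hNN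
  have h1 : screwPivot (N * N) ≤
      2 * zetaScrew (Real.log (((N * N : ℕ) : ℝ) / (((N * N : ℕ) : ℝ) - 1))) :=
    screwPivot_le_two_zetaScrew_log_div (N * N) (by omega) (hPD _)
  have h2 := incrementEnergy_le (N * N) hNN
  have h3 : ((N * N : ℕ) : ℝ) * screwPivot (N * N) ≤
      ((N * N : ℕ) : ℝ) * (2 * zetaScrew (Real.log (((N * N : ℕ) : ℝ) / (((N * N : ℕ) : ℝ) - 1)))) :=
    mul_le_mul_of_nonneg_left h1 (by linarith)
  -- hence c₀ ≤ (log N² + 19)/(N² - 1) ≤ (2N + 19)/(N² - 1)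
  have hlog : Real.log ((N * N : ℕ) : ℝ) ≤ 2 * Real.sqrt ((N * N : ℕ) : ℝ) :=
    log_le_two_sqrt _ (by linarith)
  have hsq : Real.sqrt ((N * N : ℕ) : ℝ) = N := by
    push_cast
    exact Real.sqrt_mul_self (by linarith)
  rw [hsq] at hlog
  have hcast : ((N * N : ℕ) : ℝ) = (N : ℝ) * N := by push_cast; ring
  have hc0le : pivotLawConst ≤ (Real.log ((N * N : ℕ) : ℝ) + 19) / (((N * N : ℕ) : ℝ) - 1) := by
    linarith
  rw [hcast] at hc0le hlog
  rw [le_div_iff₀ (by nlinarith)] at hc0le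
  -- pivotLawConst * (N*N - 1) ≤ log(N²) + 19 ≤ 2N + 19, contradiction with c₀ N > 42, N ≥ 2
  nlinarith

/-- **REFUTED given the certified base: «the pivots are eventually non-decreasing».**  With
`FIN(H+1)` in hand, a non-decreasing pivot tail above `H` would give a uniform pivot floor,
contradicting `not_pivotFloor`.  (As a splitting conjunct it WOULD have been valid:
`FIN(H+1) ∧ (d non-decreasing above H) → TAIL(H) → RH`.) -/
theorem not_nondecreasingTail (H : ℕ) (hH : 1 ≤ H) (hA : (∀ M : ℕ, 2 ≤ M → M ≤ H + 1 → 0 < screwPivot M)) :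
    ¬ (∀ M : ℕ, H < M → screwPivot M ≤ screwPivot (M + 1)) := by
  intro hinc
  have hmono : ∀ n : ℕ, screwPivot (H + 1) ≤ screwPivot (H + 1 + n) := by
    intro n
    induction n with
    | zero => simp
    | succ n ih => exact le_trans ih (hinc (H + 1 + n) (by omega))
  obtain ⟨M₁, hM₁mem, hM₁min⟩ :=
    (Finset.Icc 2 (H + 1)).exists_min_image screwPivot ⟨2, Finset.mem_Icc.2 ⟨le_rfl, by omega⟩⟩
  have hM₁ := Finset.mem_Icc.1 hM₁mem
  apply not_pivotFloor
  refine ⟨screwPivot M₁, hA M₁ hM₁.1 hM₁.2, fun M hM => ?_⟩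
  rcases Nat.lt_or_ge (H + 1) M with hlt | hle
  · obtain ⟨n, rfl⟩ : ∃ n, M = H + 1 + n := ⟨M - (H + 1), by omega⟩
    exact le_trans (hM₁min (H + 1) (Finset.mem_Icc.2 ⟨by omega, le_rfl⟩)) (hmono n)
  · exact hM₁min M (Finset.mem_Icc.2 ⟨hM, hle⟩)

/-- Kernel instance: for every cut `H ≤ 511` the non-decreasing pivot tail is FALSE outright. -/
theorem not_nondecreasingTail_of_le_511 (H : ℕ) (hH : H ≤ 511) :
    ¬ (∀ M : ℕ, H < M → screwPivot M ≤ screwPivot (M + 1)) := fun hinc =>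
  not_nondecreasingTail (max H 1) (le_max_right _ _)
    (fun M hM hMH => screwBase_512 M hM (by omega)) (fun M hM => hinc M (by omega))

/-- **REFUTED outright for every cut `121 ≤ H ≤ 512`** (and RH-inconsistent for every cut, next
theorem): at the first level above the cut the certified base makes `S_{M-1}` positive definite, and
the landed arithmetic deficit floor `deficit_mul_log_ge` (`G(M)·log M ≥ log²2 − 57/(M−2) > 0` for
`M ≥ 122`) makes the deficit STRICTLY positive. -/
theorem not_zeroDeficitTail (H : ℕ) (h121 : 121 ≤ H) (hA : (∀ M : ℕ, 2 ≤ M → M ≤ H → 0 < screwPivot M)) : ¬ (∀ M : ℕ, H < M → 2 * zetaScrew (Real.log ((M : ℝ) / ((M : ℝ) - 1))) ≤ screwPivot M) := by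
  intro hB
  have hPD : (screwMatrix (H - 1)).PosDef :=
    screwMatrix_posDef_of_screwPivot_pos_le (H - 1) (fun M hM hMH => hA M hM (by omega)) (H - 1) le_rfl
  have hidx : H + 1 - 2 = H - 1 := by omega
  have hdef := deficit_mul_log_ge (H + 1) (by omega) (by rw [hidx]; exact hPD)
  have hB1 := hB (H + 1) (by omega)
  have hHr : (122 : ℝ) ≤ ((H + 1 : ℕ) : ℝ) := by exact_mod_cast (by omega : 122 ≤ H + 1)
  have hlogM : 0 ≤ Real.log ((H + 1 : ℕ) : ℝ) := Real.log_nonneg (by linarith)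
  have hl2 : 0.6931471803 < Real.log 2 := Real.log_two_gt_d9
  -- the deficit term is ≤ 0 by hB1, while the floor is > 0
  have hnonpos : ((H + 1 : ℕ) : ℝ) * (2 * zetaScrew (Real.log (((H + 1 : ℕ) : ℝ) / (((H + 1 : ℕ) : ℝ) - 1)))
      - screwPivot (H + 1)) * Real.log ((H + 1 : ℕ) : ℝ) ≤ 0 := by
    apply mul_nonpos_of_nonpos_of_nonneg _ hlogM
    exact mul_nonpos_of_nonneg_of_nonpos (by linarith) (by linarith)
  have hfloor : 0 < Real.log 2 ^ 2 - 57 / (((H + 1 : ℕ) : ℝ) - 2) := by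
    have h57 : 57 / (((H + 1 : ℕ) : ℝ) - 2) ≤ 57 / 120 :=
      div_le_div_of_nonneg_left (by norm_num) (by norm_num) (by linarith)
    nlinarith
  linarith

/-- Kernel instance: the «zero deficit» tail is FALSE above every cut `121 ≤ H ≤ 512` (base `screwBase_512`). [folklore] -/
theorem not_zeroDeficitTail_of_le_512 (H : ℕ) (h121 : 121 ≤ H) (h512 : H ≤ 512) :
    ¬ (∀ M : ℕ, H < M → 2 * zetaScrew (Real.log ((M : ℝ) / ((M : ℝ) - 1))) ≤ screwPivot M) :=
  not_zeroDeficitTail H h121 fun M hM hMH => screwBase_512 M hM (by omega)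

/-- … and RH-INCONSISTENT for every cut (under RH all screw matrices are positive definite). -/
theorem not_rh_of_zeroDeficitTail (H : ℕ) (hB : (∀ M : ℕ, H < M → 2 * zetaScrew (Real.log ((M : ℝ) / ((M : ℝ) - 1))) ≤ screwPivot M)) : ¬ _root_.RiemannHypothesis :=
  fun hRH => not_zeroDeficitTail (max H 121) (le_max_right _ _)
    (fun M hM _ => (riemannHypothesis_iff_screwPivot_pos.mp hRH) M hM) (fun M hM => hB M (by omega))

end Summit.RiemannHypothesis.RiemannHypothesis.Theorems.Splittings.CostumeDetectorsScrew

end
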